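import Mathlib
import Summits.Ventures.PercRepro2.RowC1DetHFresh
import Summits.Ventures.PercRepro2.RowC1Star
import Summits.Ventures.PercRepro2.RowC1OLN
import Summits.Ventures.PercRepro2.RowC1OHN

/-!
# The two signs of the sharper row (ROW+) (blind cell PercRepro2, p2 g32; proofs/P2-G32-STAR.md §12)

With `Q = {a₁ ↮ a₂}`, `L = C(a₁)`, `H = C(a₂)`, `oL = {o ∈ L}`, `oH = {o ∈ H}`, `oN = Q ∖ (oL ∪ oH)`:
the REPULSION `condH_oL_le_oN`: `P(b ∈ H | Q, o ∈ L) ≤ P(b ∈ H | Q, o rootless)` (explore the cluster of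
`a₂` avoiding `{a₁, o}`; `bhk_induced`), and the ATTRACTION `condH_oH_ge_oN`:
`P(b ∈ H | Q, o ∈ H) ≥ P(b ∈ H | Q, o rootless)` (explore the cluster of `a₁` avoiding `{a₂, o}`; Harris in
the fresh graph for `{o ∈ C(a₂)}`, `{b ∈ C(a₂)}`; `bhk_induced`).  Part I of `RowC1RowPlus.lean`.  Std axioms.
-/
namespace Summit.Ventures.PercRepro2

namespace RowC1

section RowPlusSigns

open Classical

variable {V : Type*} {E : Type*} [Fintype E] [DecidableEq E] [Fintype V] [DecidableEq V]
  {R : Type*} [CommRing R] [LinearOrder R] [IsStrictOrderedRing R]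

/-! ### The repulsion sign: explore the cluster of `a₂` avoiding `{a₁, o}` -/

omit [Fintype E] [DecidableEq E] [Fintype V] [DecidableEq V] in
/-- `{Q, o ∈ L, b ∈ H}` as an exploration event of the cluster of `a₂`. -/
lemma evH_oL_bH (ends : E → Sym2 V) (a₁ a₂ o b : V) :
    connEvent ends a₁ o ∩ connEvent ends a₂ b ∩ (connEvent ends a₁ a₂)ᶜ =
      clusterInEvent ends a₂ (avoidOmemB o b) ∩ clusterInEvent ends a₁ {C : Set V | o ∈ C} ∩
        (connEvent ends a₂ a₁)ᶜ := by
  ext ω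
  constructor
  · rintro ⟨⟨ho, hb⟩, hQ⟩
    have ho' : Conn ends ω a₁ o := ho
    have hQ' : ¬ Conn ends ω a₁ a₂ := hQ
    exact ⟨⟨⟨fun h => hQ' (conn_trans ho' (conn_symm h)), hb⟩, ho'⟩, fun h => hQ' (conn_symm h)⟩
  · rintro ⟨⟨⟨_, hbC⟩, ho⟩, hQ⟩
    have hQ' : ¬ Conn ends ω a₂ a₁ := hQ
    exact ⟨⟨ho, hbC⟩, fun h => hQ' (conn_symm h)⟩

omit [Fintype E] [DecidableEq E] [Fintype V] [DecidableEq V] in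
/-- `{Q, o rootless, b ∈ H}` as an exploration event of the cluster of `a₂`. -/
lemma evH_oN_bH (ends : E → Sym2 V) (a₁ a₂ o b : V) :
    (connEvent ends a₁ o ∪ connEvent ends a₂ o)ᶜ ∩ connEvent ends a₂ b ∩
        (connEvent ends a₁ a₂)ᶜ =
      clusterInEvent ends a₂ (avoidOmemB o b) ∩ clusterInEvent ends a₁ {C : Set V | o ∉ C} ∩
        (connEvent ends a₂ a₁)ᶜ := by
  ext ω
  constructor
  · rintro ⟨⟨ho, hb⟩, hQ⟩
    simp only [Set.mem_compl_iff, Set.mem_union, not_or] at ho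
    have hQ' : ¬ Conn ends ω a₁ a₂ := hQ
    exact ⟨⟨⟨ho.2, hb⟩, ho.1⟩, fun h => hQ' (conn_symm h)⟩
  · rintro ⟨⟨⟨hoC, hbC⟩, ho⟩, hQ⟩
    have hQ' : ¬ Conn ends ω a₂ a₁ := hQ
    refine ⟨⟨?_, hbC⟩, fun h => hQ' (conn_symm h)⟩
    simp only [Set.mem_compl_iff, Set.mem_union, not_or]
    exact ⟨ho, hoC⟩

/-- **The repulsion sign of (ROW+)**: `P(Q, o ∈ L, b ∈ H) · P(Q, o rootless) ≤ P(Q, o ∈ L) · P(Q, o rootless, b ∈ H)`. -/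
theorem condH_oL_le_oN (p : E → R) (hp : IsProbVec p) (ends : E → Sym2 V) (a₁ a₂ o b : V) :
    prob p (connEvent ends a₁ o ∩ connEvent ends a₂ b ∩ (connEvent ends a₁ a₂)ᶜ) *
        prob p ((connEvent ends a₁ o ∪ connEvent ends a₂ o)ᶜ ∩ (connEvent ends a₁ a₂)ᶜ) ≤
      prob p (connEvent ends a₁ o ∩ (connEvent ends a₁ a₂)ᶜ) *
        prob p ((connEvent ends a₁ o ∪ connEvent ends a₂ o)ᶜ ∩ connEvent ends a₂ b ∩
          (connEvent ends a₁ a₂)ᶜ) := by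
  rw [evH_oL_bH, ev_oN, ev_oL, evH_oN_bH, prob_clusterIn_inter_eq_expect,
    prob_clusterIn_inter_eq_expect, prob_clusterIn_inter_eq_expect, prob_clusterIn_inter_eq_expect]
  simp only [delClusterProb_notMem_eq]
  set γ : Config E → R := fun ω => delClusterProb p ends a₁ {C : Set V | o ∈ C} (cluster ends ω a₂)
    with hγ
  set ι : Config E → R := fun ω => {C : Set V | b ∈ C}.indicator 1 (cluster ends ω a₂) with hι
  set I : Config E → R := fun ω => avoidIndO ends a₁ a₂ o ω with hI
  have r1 : (fun ω => (avoidOmemB o b).indicator 1 (cluster ends ω a₂) * γ ω *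
      ((connEvent ends a₂ a₁)ᶜ).indicator 1 ω) = fun ω => ι ω * γ ω * I ω := by
    funext ω
    simp only [hγ, hι, hI, avoidIndO, indicator_avoidOmemB]
    ring
  have r2 : (fun ω => (avoidO o).indicator 1 (cluster ends ω a₂) * (1 - γ ω) *
      ((connEvent ends a₂ a₁)ᶜ).indicator 1 ω) = fun ω => (1 - γ ω) * I ω := by
    funext ω
    simp only [hγ, hI, avoidIndO]
    ring
  have r3 : (fun ω => (avoidO o).indicator 1 (cluster ends ω a₂) * γ ω *
      ((connEvent ends a₂ a₁)ᶜ).indicator 1 ω) = fun ω => γ ω * I ω := by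
    funext ω
    simp only [hγ, hI, avoidIndO]
    ring
  have r4 : (fun ω => (avoidOmemB o b).indicator 1 (cluster ends ω a₂) * (1 - γ ω) *
      ((connEvent ends a₂ a₁)ᶜ).indicator 1 ω) = fun ω => (1 - γ ω) * ι ω * I ω := by
    funext ω
    simp only [hγ, hι, hI, avoidIndO, indicator_avoidOmemB]
    ring
  rw [r1, r2, r3, r4]
  have key := bhk_oL_step p hp ends a₁ a₂ o b
  simp only [← hI] at key
  have x1 : expect p (fun ω => (1 - γ ω) * I ω) = expect p I - expect p (fun ω => γ ω * I ω) :=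
    expect_one_sub_mul p γ I
  have x2 : expect p (fun ω => (1 - γ ω) * ι ω * I ω) =
      expect p (fun ω => ι ω * I ω) - expect p (fun ω => γ ω * ι ω * I ω) :=
    expect_one_sub_mul_mul p γ ι I
  have x3 : (fun ω => ι ω * γ ω * I ω) = fun ω => γ ω * ι ω * I ω := by
    funext ω; ring
  rw [x1, x2] at key
  rw [x1, x2, x3]
  nlinarith [key]

/-! ### The attraction sign: explore the cluster of `a₁` avoiding `{a₂, o}` -/

omit [Fintype E] [DecidableEq E] [Fintype V] [DecidableEq V] in
/-- `{Q, o ∈ H, b ∈ H}` as an exploration event of the cluster of `a₁`. -/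
lemma evA_oH_bH (ends : E → Sym2 V) (a₁ a₂ o b : V) :
    connEvent ends a₂ o ∩ connEvent ends a₂ b ∩ (connEvent ends a₁ a₂)ᶜ =
      clusterInEvent ends a₁ {C : Set V | o ∉ C} ∩
        clusterInEvent ends a₂ {C : Set V | b ∈ C ∧ o ∈ C} ∩ (connEvent ends a₁ a₂)ᶜ := by
  ext ω
  constructor
  · rintro ⟨⟨ho, hb⟩, hQ⟩
    exact ⟨⟨notMem_cluster_a₁_of_oH hQ ho, ⟨hb, ho⟩⟩, hQ⟩
  · rintro ⟨⟨_, ⟨hb, ho⟩⟩, hQ⟩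
    exact ⟨⟨ho, hb⟩, hQ⟩

omit [Fintype E] [DecidableEq E] [Fintype V] [DecidableEq V] in
/-- `{Q, o rootless}` as an exploration event of the cluster of `a₁`. -/
lemma evA_oN (ends : E → Sym2 V) (a₁ a₂ o : V) :
    (connEvent ends a₁ o ∪ connEvent ends a₂ o)ᶜ ∩ (connEvent ends a₁ a₂)ᶜ =
      clusterInEvent ends a₁ {C : Set V | o ∉ C} ∩ clusterInEvent ends a₂ {C : Set V | o ∉ C} ∩
        (connEvent ends a₁ a₂)ᶜ := by
  ext ω
  simp only [Set.mem_inter_iff, Set.mem_compl_iff, Set.mem_union, not_or, mem_clusterInEvent]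
  constructor
  · rintro ⟨⟨h1, h2⟩, hQ⟩
    exact ⟨⟨h1, h2⟩, hQ⟩
  · rintro ⟨⟨h1, h2⟩, hQ⟩
    exact ⟨⟨h1, h2⟩, hQ⟩

omit [Fintype E] [DecidableEq E] [Fintype V] [DecidableEq V] in
/-- `{Q, o ∈ H}` as an exploration event of the cluster of `a₁`. -/
lemma evA_oH (ends : E → Sym2 V) (a₁ a₂ o : V) :
    connEvent ends a₂ o ∩ (connEvent ends a₁ a₂)ᶜ =
      clusterInEvent ends a₁ {C : Set V | o ∉ C} ∩ clusterInEvent ends a₂ {C : Set V | o ∈ C} ∩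
        (connEvent ends a₁ a₂)ᶜ := by
  ext ω
  constructor
  · rintro ⟨ho, hQ⟩
    exact ⟨⟨notMem_cluster_a₁_of_oH hQ ho, ho⟩, hQ⟩
  · rintro ⟨⟨_, ho⟩, hQ⟩
    exact ⟨ho, hQ⟩

omit [Fintype E] [DecidableEq E] [Fintype V] [DecidableEq V] in
/-- `{Q, o rootless, b ∈ H}` as an exploration event of the cluster of `a₁`. -/
lemma evA_oN_bH (ends : E → Sym2 V) (a₁ a₂ o b : V) :
    (connEvent ends a₁ o ∪ connEvent ends a₂ o)ᶜ ∩ connEvent ends a₂ b ∩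
        (connEvent ends a₁ a₂)ᶜ =
      clusterInEvent ends a₁ {C : Set V | o ∉ C} ∩
        clusterInEvent ends a₂ {C : Set V | b ∈ C ∧ o ∉ C} ∩ (connEvent ends a₁ a₂)ᶜ := by
  ext ω
  simp only [Set.mem_inter_iff, Set.mem_compl_iff, Set.mem_union, not_or, mem_clusterInEvent]
  constructor
  · rintro ⟨⟨⟨h1, h2⟩, hb⟩, hQ⟩
    exact ⟨⟨h1, ⟨hb, h2⟩⟩, hQ⟩
  · rintro ⟨⟨h1, ⟨hb, h2⟩⟩, hQ⟩
    exact ⟨⟨⟨h1, h2⟩, hb⟩, hQ⟩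

/-- **The BHK step for the attraction sign**: with `f = f_b(C₁)`, `g = f_o(C₁)` (`freshH`) and `I` the
avoidance indicator of `{a₁ ↮ {a₂, o}}`, `E[(1 − g) I]·E[(1 − f) I] ≤ E[(1 − g)(1 − f) I]·E[I]`. -/
theorem bhk_avoidO_step (p : E → R) (hp : IsProbVec p) (ends : E → Sym2 V) (a₁ a₂ o b : V) :
    expect p (fun ω => (1 - freshH p ends a₂ o (cluster ends ω a₁)) * avoidIndA ends a₁ a₂ o ω) *
      expect p (fun ω => (1 - freshH p ends a₂ b (cluster ends ω a₁)) * avoidIndA ends a₁ a₂ o ω) ≤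
    expect p (fun ω => (1 - freshH p ends a₂ o (cluster ends ω a₁)) *
        (1 - freshH p ends a₂ b (cluster ends ω a₁)) * avoidIndA ends a₁ a₂ o ω) *
      expect p (fun ω => avoidIndA ends a₁ a₂ o ω) := by
  have hF₁ : Monotone (fun K : Set V => 1 - freshH p ends a₂ o K) :=
    fun K K' h => sub_le_sub_left (freshH_anti p hp ends a₂ o h) 1
  have hF₂ : Monotone (fun K : Set V => 1 - freshH p ends a₂ b K) :=
    fun K K' h => sub_le_sub_left (freshH_anti p hp ends a₂ b h) 1
  have hF₁0 : ∀ K : Set V, 0 ≤ 1 - freshH p ends a₂ o K :=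
    fun K => sub_nonneg.2 (freshH_le_one p hp ends a₂ o K)
  have hF₂0 : ∀ K : Set V, 0 ≤ 1 - freshH p ends a₂ b K :=
    fun K => sub_nonneg.2 (freshH_le_one p hp ends a₂ b K)
  have h := bhk_induced p hp ends a₁ hF₁ hF₂ hF₁0 hF₂0 Finset.univ {a₂, o} {a₂, o}
    (Finset.subset_univ _) (Finset.subset_univ _)
  simp only [Finset.inter_self, Finset.union_self] at h
  have e1 : ∀ F : Set V → R, clusterObs ends Finset.univ a₁ F *
      (REvent ends Finset.univ a₁ {a₂, o}).indicator 1 =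
      fun ω => F (cluster ends ω a₁) * avoidIndA ends a₁ a₂ o ω := by
    intro F
    funext ω
    simp only [Pi.mul_apply, clusterObs_apply, clusterIn_univ, REvent_indicator_eq_avoidIndA]
  have e2 : prob p (REvent ends Finset.univ a₁ {a₂, o}) =
      expect p (fun ω => avoidIndA ends a₁ a₂ o ω) := by
    rw [prob_eq_expect_indicator]
    unfold expect
    refine Finset.sum_congr rfl fun ω _ => ?_
    rw [REvent_indicator_eq_avoidIndA]
  rw [e1, e1, e1, e2] at h
  simpa only [Pi.mul_apply] using h

/-- **The attraction sign of (ROW+)**: `P(Q, o ∈ H) · P(Q, o rootless, b ∈ H) ≤ P(Q, o ∈ H, b ∈ H) · P(Q, o rootless)`. -/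
theorem condH_oH_ge_oN (p : E → R) (hp : IsProbVec p) (ends : E → Sym2 V) (a₁ a₂ o b : V) :
    prob p (connEvent ends a₂ o ∩ (connEvent ends a₁ a₂)ᶜ) *
        prob p ((connEvent ends a₁ o ∪ connEvent ends a₂ o)ᶜ ∩ connEvent ends a₂ b ∩
          (connEvent ends a₁ a₂)ᶜ) ≤
      prob p (connEvent ends a₂ o ∩ connEvent ends a₂ b ∩ (connEvent ends a₁ a₂)ᶜ) *
        prob p ((connEvent ends a₁ o ∪ connEvent ends a₂ o)ᶜ ∩ (connEvent ends a₁ a₂)ᶜ) := by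
  rw [evA_oH, evA_oN_bH, evA_oH_bH, evA_oN, prob_clusterIn_inter_eq_expect,
    prob_clusterIn_inter_eq_expect, prob_clusterIn_inter_eq_expect, prob_clusterIn_inter_eq_expect]
  simp only [delClusterProb_notMem_eq]
  set g : Config E → R := fun ω => freshH p ends a₂ o (cluster ends ω a₁) with hg
  set f : Config E → R := fun ω => freshH p ends a₂ b (cluster ends ω a₁) with hf
  set κ₁ : Config E → R := fun ω =>
    delClusterProb p ends a₂ {C : Set V | b ∈ C ∧ o ∈ C} (cluster ends ω a₁) with hκ₁
  set κ₀ : Config E → R := fun ω =>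
    delClusterProb p ends a₂ {C : Set V | b ∈ C ∧ o ∉ C} (cluster ends ω a₁) with hκ₀
  set I : Config E → R := fun ω => avoidIndA ends a₁ a₂ o ω with hI
  have r1 : (fun ω => ({C : Set V | o ∉ C}).indicator 1 (cluster ends ω a₁) *
      delClusterProb p ends a₂ {C : Set V | o ∈ C} (cluster ends ω a₁) *
      ((connEvent ends a₁ a₂)ᶜ).indicator 1 ω) = fun ω => g ω * I ω := by
    funext ω; simp only [hg, hI, avoidIndA, freshH]; ring
  have r2 : (fun ω => ({C : Set V | o ∉ C}).indicator 1 (cluster ends ω a₁) * κ₀ ω *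
      ((connEvent ends a₁ a₂)ᶜ).indicator 1 ω) = fun ω => κ₀ ω * I ω := by
    funext ω; simp only [hκ₀, hI, avoidIndA]; ring
  have r3 : (fun ω => ({C : Set V | o ∉ C}).indicator 1 (cluster ends ω a₁) * κ₁ ω *
      ((connEvent ends a₁ a₂)ᶜ).indicator 1 ω) = fun ω => κ₁ ω * I ω := by
    funext ω; simp only [hκ₁, hI, avoidIndA]; ring
  have r4 : (fun ω => ({C : Set V | o ∉ C}).indicator 1 (cluster ends ω a₁) *
      (1 - delClusterProb p ends a₂ {C : Set V | o ∈ C} (cluster ends ω a₁)) *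
      ((connEvent ends a₁ a₂)ᶜ).indicator 1 ω) = fun ω => (1 - g ω) * I ω := by
    funext ω; simp only [hg, hI, avoidIndA, freshH]; ring
  rw [r1, r2, r3, r4]
  have hI0 : ∀ ω, 0 ≤ I ω := fun ω => avoidIndA_nonneg ends a₁ a₂ o ω
  have hg0 : ∀ ω, 0 ≤ g ω := fun ω => freshH_nonneg p hp ends a₂ o _
  have hg1 : ∀ ω, g ω ≤ 1 := fun ω => freshH_le_one p hp ends a₂ o _
  have hf0 : ∀ ω, 0 ≤ f ω := fun ω => freshH_nonneg p hp ends a₂ b _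
  have hf1 : ∀ ω, f ω ≤ 1 := fun ω => freshH_le_one p hp ends a₂ b _
  -- Harris in the fresh graph: `κ₁ ≥ f g`, `κ₀ ≤ f (1 − g)`
  have hκ₁ : ∀ ω, f ω * g ω ≤ κ₁ ω := fun ω => fresh_both_ge p hp ends a₂ o b (cluster ends ω a₁)
  have hκ₀ : ∀ ω, κ₀ ω ≤ f ω * (1 - g ω) := fun ω =>
    fresh_b_in_o_out_le p hp ends a₂ o b (cluster ends ω a₁)
  have hB1 : expect p (fun ω => f ω * g ω * I ω) ≤ expect p (fun ω => κ₁ ω * I ω) :=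
    expect_mono hp fun ω => mul_le_mul_of_nonneg_right (hκ₁ ω) (hI0 ω)
  have hB0 : expect p (fun ω => κ₀ ω * I ω) ≤ expect p (fun ω => f ω * (1 - g ω) * I ω) :=
    expect_mono hp fun ω => mul_le_mul_of_nonneg_right (hκ₀ ω) (hI0 ω)
  have n1 : 0 ≤ expect p (fun ω => g ω * I ω) :=
    expect_nonneg hp fun ω => mul_nonneg (hg0 ω) (hI0 ω)
  have n2 : 0 ≤ expect p (fun ω => (1 - g ω) * I ω) :=
    expect_nonneg hp fun ω => mul_nonneg (sub_nonneg.2 (hg1 ω)) (hI0 ω)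
  have key := bhk_avoidO_step p hp ends a₁ a₂ o b
  simp only [← hI] at key
  have x1 : expect p (fun ω => (1 - g ω) * I ω) = expect p I - expect p (fun ω => g ω * I ω) :=
    expect_one_sub_mul p g I
  have x2 : expect p (fun ω => (1 - f ω) * I ω) = expect p I - expect p (fun ω => f ω * I ω) :=
    expect_one_sub_mul p f I
  have x3 : expect p (fun ω => (1 - g ω) * (1 - f ω) * I ω) = expect p I -
      expect p (fun ω => g ω * I ω) - expect p (fun ω => f ω * I ω) +
      expect p (fun ω => g ω * f ω * I ω) := expect_one_sub_mul_one_sub_mul p g f I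
  have x4 : expect p (fun ω => f ω * (1 - g ω) * I ω) =
      expect p (fun ω => f ω * I ω) - expect p (fun ω => f ω * g ω * I ω) :=
    expect_mul_one_sub_mul p f g I
  have x5 : (fun ω => g ω * f ω * I ω) = fun ω => f ω * g ω * I ω := by
    funext ω; ring
  rw [x1, x2, x3, x5] at key
  rw [x4] at hB0
  rw [x1]
  nlinarith [key, hB1, hB0, n1, n2, mul_le_mul_of_nonneg_left hB0 n1,
    mul_le_mul_of_nonneg_right hB1 n2]

end RowPlusSigns

end RowC1

end Summit.Ventures.PercRepro2
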